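import Summits.QuantumFields.YangMills.Theorems.UnitScaleTiltHalvingH59GammaDischargeFlat
import HarnessLib

/-!
# Route `UnitScaleTilt`, crux K1 child «MinimiserStabilityRegPr» (stmt-QuantumFields-19200), registered stub `stub_halvingStep` (v10 `BirthV10`), line H, ROAD γ∕ρ5 —
# ★★ «(γ-6) ALL LEVELS» (LOCATE (L-B) file (1)): THE PER-DATUM γ (1.59) TWO-LINE CLAUSE AT THE FLAT BACKGROUND, AT EVERY TRUNCATION `1 ≤ m ≤ K − n`, over print's split class
# `cubeLamBP′ … (K−n) m`, in the «ρ5» member letters — the (1.59) in-edge `H59Dβ : ∀ m, 1 ≤ m → m ≤ k → …` of the lit γ Theorem-4 driver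
# ✓`B8Thm4KLevelGamma.thm4_exists_all_levels_supp_landau138_γ(_mem)` and the per-truncation `H59Dβm` of the γ Prop-5 join ✓`B8SockHFP59GammaTraceFree.…`, BOTH at `U₀ = 1`,
# discharged on print's p. 98 sub-lattice by lit ✓`ineq159FlatCubeMemberPrinted_holds_L3` → ✓`sc4_cubeMember_of_ineq159Printed` (∀ `1 ≤ m ≤ k`) → ✓`twoLine_mono` → ✓`flat159_clause_of_scalar_bdryβ`.

Cell `ym3-torus` (HUMAN RULING D-0037: YM₃ on T³ is ladder rung R3 — NOT d = 4, NOT a mass gap, NOT the Clay problem), width seat `ym3-torus-px10` gen 3 (LEAD-H g7 WORD 4∕11 (L-B)).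
`--supports stmt-QuantumFields-19200 --as helper`; THEOREMS ONLY (0 `def`, 0 `sorry`); count-neutral; nothing here claims Theorem 4, the stub, the crux or the gap.

WHAT IS PROVED (ns `…Theorems.HalvingH59GammaDischargeFlatAllLevels`): ★★ `H59D_allLevels_flat_member5 (L) (hL : 1 < L)` —
`∃ Bs sx ρ₅, 1 ≤ Bs ∧ ∀ F (F.L = L) n K (n < K) a M′ ρ′, L ≤ ρ′ → L^(sx+1) ∣ ρ′ → L^(sx+1) ∣ M′ → ρ₅ ≤ ρ′ → ∀ B₀ Bbd c, Bs ≤ B₀ → Bs ≤ Bbd → 0 ≤ c → c ≤ 1∕2 → ∀ m, 1 ≤ m → m ≤ K − n →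
∀ W A′, IsLandau138W … m (□ 0) (cubeLamS … (K−n) m) 1 W → (W = e^{iηA′} ∧ ‖A′‖ ≤ c(Lʲη)⁻¹ on side-touching bonds j ≤ m) → support → <two lines at truncation m over cubeLamBP′ … (K−n) m,
collar Bbd>` (`c` generic: the driver reads it at `c := 2((F.P K).L·c⋆) + 8α₄`, the join at `c := c⋆`; its `m = K − n` ∕ `m = K − n − 1` instances are ✓p687694's two shapes).
HONEST SCOPE.  By-name composition + ℕ∕ℝ bookkeeping; the (1.59) analysis is lit's; nothing of Prop. 3∕5, Thm 4, `hSupUρ5`, the stub, the crux asserted; YM₃ on T³ = rung R3 — not d = 4, not Clay, no mass gap.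

References: T. Bałaban, CMP **99** (1985) 75–102 [Balaban1985RegularSpaces] ((1.58)–(1.59) p.86, (1.62) p.87, (1.31) p.82, p.98, Thm 4 p.88, Prop. 5 p.94); CMP **99** (1985) 389–434
[Balaban1985BackgroundPropagators] (Thm 3.3 p.399, (3.47) p.398); CMP **96** (1984) 223–250 [Balaban1984PropagatorsII] ((2.3) p.224).
-/

set_option autoImplicit false

noncomputable section

open scoped BigOperators Matrix.Norms.L2Operator
open NormedSpace
open Complex (I)

namespace Summit.QuantumFields.YangMills.Theorems.HalvingH59GammaDischargeFlatAllLevels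

open Literature.MathematicalPhysics.QuantumFieldTheory.Balaban1983to89
open Literature.MathematicalPhysics.QuantumFieldTheory.Balaban1983to89.T3ContinuumYM3Torus
open Literature.MathematicalPhysics.QuantumFieldTheory.Balaban1983to89.T3PrintedRegularMinimiser (RegPr regFibrePr)
open B5Eq118OneStroke (iterBlockOf)
open B7Prop1Explicit (e)
open B7Prop1Explicit renaming Site → LSite
open B7Prop2Explicit (unitaryUnits avgIter)
open B7Prop1Local (InBox loK bondHiK)
open B7Eq92Concrete (mgauge)
open B8Ineq130 (tlo thi)
open B8Ineq132 (covDerivFwd InAk BondTouches)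
open B8Eq119TwistedAxial (Restr129 InAx)
open B8Eq131Cubes (tLo tHi)
open B8Eq131CubesAdmissible (cubeFam)
open B8CubeMemberZd (cubeLamS cubeLamB)
open B8Eq184Proof (cfgExp)
open B8Eq140Level (SideTouches)
open B8Eq146AExpansion (iEta)
open B8Eq138LandauZd (IsLandau138 IsLandau138W)
open B7Prop4GeneralLevels (linCovIter)
open B8Eq155JBound (Jcur wsup wsup_nonneg)
open B8ScaledSupNorm (bondNorm msup msup_nonneg)
open B9SupplySockB9P3ZdBeta (CrossB)
open B9SupplySockB9P3ZdGamma (cubeLamBP')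
open B8Ineq159FlatCubeMemberPrinted (cubeLamBP Ineq159FlatCubeMemberPrinted)
open B8Ineq159FlatCubeMemberTransplantL3 (ineq159FlatCubeMemberPrinted_holds_L3)
open B8Ineq159FlatCubeMemberSCGamma (sc4_cubeMember_of_ineq159Printed cubeLamBP_sub_splitIndex)
open B8Ineq159FlatOfScalarBdryBeta (flat159_clause_of_scalar_bdryβ)
open B10Eq27TorusAxialLog (pull pull_apply unitsField toUField gaugeActT)
open B15Eq112TorusCover (cover)
open HalvingH59GammaDischargeFlat (twoLine_mono)

/-! ## ★★ The per-datum γ (1.59) clause at every truncation, ρ5 letters -/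

/-- ★★ **«(γ-6) ALL LEVELS»**: the per-datum two-line γ (1.59) clause at `U₀ = 1` at EVERY truncation `1 ≤ m ≤ K − n` over `cubeLamBP′ … (K−n) m` on print's p. 98 sub-lattice, «ρ5» letters
(`∃ Bs sx ρ₅` per `L`; member antecedents `L ≤ ρ′`, `L^(sx+1) ∣ ρ′`, `L^(sx+1) ∣ M′`, `ρ₅ ≤ ρ′`), all `B₀, Bbd ≥ Bs`, exponent radius `0 ≤ c ≤ 1∕2`.
[cite: Balaban1985RegularSpaces, (1.58)-(1.59) p.86, (1.62) p.87, (1.31) p.82, p.98, Thm 4 p.88; Balaban1985BackgroundPropagators, Thm 3.3 p.399, (3.47) p.398; Balaban1984PropagatorsII, (2.3) p.224] -/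
theorem H59D_allLevels_flat_member5 (L : ℕ) (hL : 1 < L) :
    ∃ Bs : ℝ, ∃ sx ρ₅ : ℕ, 1 ≤ Bs ∧
    ∀ (F : T3Family), F.L = L → ∀ (n K : ℕ), n < K →
    ∀ (a : LSite (F.P K).d) (M' ρ' : ℕ), L ≤ ρ' → L ^ (sx + 1) ∣ ρ' → L ^ (sx + 1) ∣ M' → ρ₅ ≤ ρ' →
    ∀ (B₀ Bbd c : ℝ), Bs ≤ B₀ → Bs ≤ Bbd → 0 ≤ c → c ≤ 1 / 2 →
    ∀ (m : ℕ), 1 ≤ m → m ≤ K - n →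
    ∀ (W : LSite (F.P K).d → Fin (F.P K).d → (Matrix (Fin 2) (Fin 2) ℂ)ˣ) (A' : LSite (F.P K).d → Fin (F.P K).d → (Matrix (Fin 2) (Fin 2) ℂ)),
      IsLandau138W (F.P K).L m (((F.L : ℝ)⁻¹) ^ (K - n)) ((cubeFam false (F.P K).L a M' ρ' (K - n)) 0) (cubeLamS (F.P K).L a M' ρ' (K - n) m)
        (1 : LSite (F.P K).d → Fin (F.P K).d → (Matrix (Fin 2) (Fin 2) ℂ)ˣ) W →
      (∀ j, j ≤ m → ∀ y τ, SideTouches ((cubeFam false (F.P K).L a M' ρ' (K - n)) j) y τ →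
        W y τ = cfgExp (((F.L : ℝ)⁻¹) ^ (K - n)) A' y τ ∧ ‖A' y τ‖ ≤ c * (((F.P K).L : ℝ) ^ j * (((F.L : ℝ)⁻¹) ^ (K - n)))⁻¹) →
      (∀ y τ, (∀ j, j ≤ m → ¬ SideTouches ((cubeFam false (F.P K).L a M' ρ' (K - n)) j) y τ) → A' y τ = 0) →
      msup (F.P K).L (m) (((F.L : ℝ)⁻¹) ^ (K - n)) (-(1 : ℝ)) (fun j (b : LSite (F.P K).d × Fin (F.P K).d) => SideTouches ((cubeFam false (F.P K).L a M' ρ' (K - n)) j) b.1 b.2) (fun b => A' b.1 b.2)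
            ≤ B₀ * (bondNorm (F.P K).L (m) (((F.L : ℝ)⁻¹) ^ (K - n)) (-(3 : ℝ)) (cubeFam false (F.P K).L a M' ρ' (K - n)) (fun x μ => Jcur (((F.L : ℝ)⁻¹) ^ (K - n)) (1 : LSite (F.P K).d → Fin (F.P K).d → (Matrix (Fin 2) (Fin 2) ℂ)ˣ) A' μ x)
              + wsup 1 (fun p : {p : ℕ × (LSite (F.P K).d × Fin (F.P K).d) // p.1 ≤ m ∧ (p.2 ∈ (cubeLamBP' (F.P K).L a M' ρ' (K - n) m) p.1 ∨ (p.1 = 0 ∧ CrossB ((cubeFam false (F.P K).L a M' ρ' (K - n)) 0) p.2))} =>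
                  linCovIter (F.P K).L (1 : LSite (F.P K).d → Fin (F.P K).d → (Matrix (Fin 2) (Fin 2) ℂ)ˣ) (iEta (((F.L : ℝ)⁻¹) ^ (K - n)) A') p.1.1 p.1.2.1 p.1.2.2))
              + Bbd * msup (F.P K).L (m) (((F.L : ℝ)⁻¹) ^ (K - n)) (-(1 : ℝ)) (fun j (b : LSite (F.P K).d × Fin (F.P K).d) => j = 0 ∧ SideTouches ((cubeFam false (F.P K).L a M' ρ' (K - n)) 0) b.1 b.2 ∧ ¬ BondTouches ((cubeFam false (F.P K).L a M' ρ' (K - n)) 0) b.1 b.2)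
                  (fun b => A' b.1 b.2) ∧
          msup (F.P K).L (m) (((F.L : ℝ)⁻¹) ^ (K - n)) (-(2 : ℝ)) (fun j (t : Fin (F.P K).d × Fin (F.P K).d × LSite (F.P K).d) => SideTouches ((cubeFam false (F.P K).L a M' ρ' (K - n)) j) t.2.2 t.2.1)
              (fun t => covDerivFwd (((F.L : ℝ)⁻¹) ^ (K - n)) (1 : LSite (F.P K).d → Fin (F.P K).d → (Matrix (Fin 2) (Fin 2) ℂ)ˣ) t.1 (fun z => A' z t.2.1) t.2.2)
            ≤ B₀ * (bondNorm (F.P K).L (m) (((F.L : ℝ)⁻¹) ^ (K - n)) (-(3 : ℝ)) (cubeFam false (F.P K).L a M' ρ' (K - n)) (fun x μ => Jcur (((F.L : ℝ)⁻¹) ^ (K - n)) (1 : LSite (F.P K).d → Fin (F.P K).d → (Matrix (Fin 2) (Fin 2) ℂ)ˣ) A' μ x)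
              + wsup 1 (fun p : {p : ℕ × (LSite (F.P K).d × Fin (F.P K).d) // p.1 ≤ m ∧ (p.2 ∈ (cubeLamBP' (F.P K).L a M' ρ' (K - n) m) p.1 ∨ (p.1 = 0 ∧ CrossB ((cubeFam false (F.P K).L a M' ρ' (K - n)) 0) p.2))} =>
                  linCovIter (F.P K).L (1 : LSite (F.P K).d → Fin (F.P K).d → (Matrix (Fin 2) (Fin 2) ℂ)ˣ) (iEta (((F.L : ℝ)⁻¹) ^ (K - n)) A') p.1.1 p.1.2.1 p.1.2.2))
              + Bbd * msup (F.P K).L (m) (((F.L : ℝ)⁻¹) ^ (K - n)) (-(1 : ℝ)) (fun j (b : LSite (F.P K).d × Fin (F.P K).d) => j = 0 ∧ SideTouches ((cubeFam false (F.P K).L a M' ρ' (K - n)) 0) b.1 b.2 ∧ ¬ BondTouches ((cubeFam false (F.P K).L a M' ρ' (K - n)) 0) b.1 b.2)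
                  (fun b => A' b.1 b.2) := by
  classical
  have hL1 : 1 ≤ L := hL.le
  have hL2 : 2 ≤ L := hL
  by_cases hodd : Odd L
  · -- the lit fact at `(d, L) = (3, L)` and its scalar four-line clause, constants uniform on the sub-lattice, every truncation `1 ≤ m ≤ k`
    obtain ⟨ℓ, hℓ⟩ : ∃ ℓ, L = ℓ + 1 := ⟨L - 1, by omega⟩
    have h159 : Ineq159FlatCubeMemberPrinted 3 L := by
      rw [hℓ]; exact ineq159FlatCubeMemberPrinted_holds_L3 2 ℓ (by omega) (hℓ ▸ hodd)
    obtain ⟨B₀l, ρ₀, M₀, N₀, R₀, hB₀l, H⟩ := sc4_cubeMember_of_ineq159Printed (d := 3) (by norm_num) hL1 h159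
    -- the ρ5 letters: `sx := ⌈M₀⌉₊`, `ρ₅ := max ⌈ρ₀⌉₊ (max (R₀·L^(sx+1)) (N₀+1))`
    refine ⟨B₀l, ⌈M₀⌉₊, max ⌈ρ₀⌉₊ (max (R₀ * L ^ (⌈M₀⌉₊ + 1)) (N₀ + 1)), hB₀l, ?_⟩
    intro F hF n K hnK a M' ρ' hρL hdiv hdM hρ₅ B₀ Bbd c hB hBbd hc0 hc m hm1 hmk W A' hLan hWA hA0
    -- the seven sub-lattice guards from the three antecedents
    have hpowpos : 0 < L ^ (⌈M₀⌉₊ + 1) := Nat.pos_of_ne_zero (pow_ne_zero _ (by omega))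
    have hM₀' : M₀ ≤ (L : ℝ) ^ (⌈M₀⌉₊ + 1) := by
      have h1 : M₀ ≤ (⌈M₀⌉₊ : ℝ) := Nat.le_ceil _
      have h2 : ⌈M₀⌉₊ + 1 ≤ L ^ (⌈M₀⌉₊ + 1) := (Nat.lt_pow_self (by omega)).le
      have h3 : ((⌈M₀⌉₊ : ℕ) : ℝ) + 1 ≤ ((L ^ (⌈M₀⌉₊ + 1) : ℕ) : ℝ) := by exact_mod_cast h2
      push_cast at h3
      linarith
    have hRx : ρ' / L ^ (⌈M₀⌉₊ + 1) * L ^ (⌈M₀⌉₊ + 1) = ρ' := Nat.div_mul_cancel hdiv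
    have hRρ : ρ' / L ^ (⌈M₀⌉₊ + 1) * L ^ (⌈M₀⌉₊ + 1) ≤ ρ' := hRx.le
    have hR₀ : R₀ ≤ ρ' / L ^ (⌈M₀⌉₊ + 1) := by
      have h1 : R₀ * L ^ (⌈M₀⌉₊ + 1) ≤ ρ' / L ^ (⌈M₀⌉₊ + 1) * L ^ (⌈M₀⌉₊ + 1) := by
        rw [hRx]; exact ((le_max_left _ _).trans (le_max_right _ _)).trans hρ₅
      exact Nat.le_of_mul_le_mul_right h1 hpowpos
    have hN₀ : N₀ + 1 ≤ ρ' / L ^ (⌈M₀⌉₊ + 1) * L ^ (⌈M₀⌉₊ + 1) := by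
      rw [hRx]; exact ((le_max_right _ _).trans (le_max_right _ _)).trans hρ₅
    have hρ₀ : ρ₀ ≤ ((ρ' : ℕ) : ℝ) := by
      have h1 : ρ₀ ≤ (⌈ρ₀⌉₊ : ℝ) := Nat.le_ceil _
      have h2 : ((⌈ρ₀⌉₊ : ℕ) : ℝ) ≤ ((ρ' : ℕ) : ℝ) := by exact_mod_cast (le_max_left _ _).trans hρ₅
      linarith
    -- align `L` with the member's letter
    subst hF
    have hη : 0 < ((F.L : ℝ)⁻¹) ^ (K - n) := by
      have hL0 : (0 : ℝ) < F.L := by exact_mod_cast (F.P K).L_pos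
      positivity
    have hk : 1 ≤ K - n := by omega
    have hρ1 : 1 ≤ ρ' := le_trans hL1 hρL
    have hI := cubeLamBP_sub_splitIndex (d := (F.P K).d) hL1 a M' hρ1 hm1 hmk
    -- the scalar two lines at `(B₀l, B₀l)` over the split index at truncation `m`, then monotone up to `(B₀, Bbd)`
    have SCALAR : ∀ φ : LSite (F.P K).d → Fin (F.P K).d → ℂ,
        IsLandau138 (F.P K).L (m) (((F.L : ℝ)⁻¹) ^ (K - n)) ((fun j => cubeFam false (F.P K).L a M' ρ' (K - n) j) 0)
          (cubeLamS (F.P K).L a M' ρ' (K - n) (m)) (1 : LSite (F.P K).d → Fin (F.P K).d → ℂˣ) φ →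
        (∀ (y : LSite (F.P K).d) (τ : Fin (F.P K).d), (∀ j, j ≤ m → ¬ SideTouches ((fun j => cubeFam false (F.P K).L a M' ρ' (K - n) j) j) y τ) → φ y τ = 0) →
        msup (F.P K).L (m) (((F.L : ℝ)⁻¹) ^ (K - n)) (-(1 : ℝ)) (fun j (b : LSite (F.P K).d × Fin (F.P K).d) => SideTouches ((fun j => cubeFam false (F.P K).L a M' ρ' (K - n) j) j) b.1 b.2) (fun b => φ b.1 b.2)
            ≤ B₀ * (bondNorm (F.P K).L (m) (((F.L : ℝ)⁻¹) ^ (K - n)) (-(3 : ℝ)) (fun j => cubeFam false (F.P K).L a M' ρ' (K - n) j) (fun x μ => Jcur (((F.L : ℝ)⁻¹) ^ (K - n)) (1 : LSite (F.P K).d → Fin (F.P K).d → ℂˣ) φ μ x)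
              + wsup 1 (fun p : {p : ℕ × (LSite (F.P K).d × Fin (F.P K).d) // p.1 ≤ m ∧ (p.2 ∈ (fun j => cubeLamBP' (F.P K).L a M' ρ' (K - n) m j) p.1 ∨ (p.1 = 0 ∧ CrossB ((fun j => cubeFam false (F.P K).L a M' ρ' (K - n) j) 0) p.2))} =>
                  linCovIter (F.P K).L (1 : LSite (F.P K).d → Fin (F.P K).d → ℂˣ) (iEta (((F.L : ℝ)⁻¹) ^ (K - n)) φ) p.1.1 p.1.2.1 p.1.2.2))
              + Bbd * msup (F.P K).L (m) (((F.L : ℝ)⁻¹) ^ (K - n)) (-(1 : ℝ)) (fun j (b : LSite (F.P K).d × Fin (F.P K).d) => j = 0 ∧ SideTouches ((fun j => cubeFam false (F.P K).L a M' ρ' (K - n) j) 0) b.1 b.2 ∧ ¬ BondTouches ((fun j => cubeFam false (F.P K).L a M' ρ' (K - n) j) 0) b.1 b.2)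
                  (fun b => φ b.1 b.2) ∧
          msup (F.P K).L (m) (((F.L : ℝ)⁻¹) ^ (K - n)) (-(2 : ℝ)) (fun j (t : Fin (F.P K).d × Fin (F.P K).d × LSite (F.P K).d) => SideTouches ((fun j => cubeFam false (F.P K).L a M' ρ' (K - n) j) j) t.2.2 t.2.1)
              (fun t => covDerivFwd (((F.L : ℝ)⁻¹) ^ (K - n)) (1 : LSite (F.P K).d → Fin (F.P K).d → ℂˣ) t.1 (fun z => φ z t.2.1) t.2.2)
            ≤ B₀ * (bondNorm (F.P K).L (m) (((F.L : ℝ)⁻¹) ^ (K - n)) (-(3 : ℝ)) (fun j => cubeFam false (F.P K).L a M' ρ' (K - n) j) (fun x μ => Jcur (((F.L : ℝ)⁻¹) ^ (K - n)) (1 : LSite (F.P K).d → Fin (F.P K).d → ℂˣ) φ μ x)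
              + wsup 1 (fun p : {p : ℕ × (LSite (F.P K).d × Fin (F.P K).d) // p.1 ≤ m ∧ (p.2 ∈ (fun j => cubeLamBP' (F.P K).L a M' ρ' (K - n) m j) p.1 ∨ (p.1 = 0 ∧ CrossB ((fun j => cubeFam false (F.P K).L a M' ρ' (K - n) j) 0) p.2))} =>
                  linCovIter (F.P K).L (1 : LSite (F.P K).d → Fin (F.P K).d → ℂˣ) (iEta (((F.L : ℝ)⁻¹) ^ (K - n)) φ) p.1.1 p.1.2.1 p.1.2.2))
              + Bbd * msup (F.P K).L (m) (((F.L : ℝ)⁻¹) ^ (K - n)) (-(1 : ℝ)) (fun j (b : LSite (F.P K).d × Fin (F.P K).d) => j = 0 ∧ SideTouches ((fun j => cubeFam false (F.P K).L a M' ρ' (K - n) j) 0) b.1 b.2 ∧ ¬ BondTouches ((fun j => cubeFam false (F.P K).L a M' ρ' (K - n) j) 0) b.1 b.2)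
                  (fun b => φ b.1 b.2) := by
      intro φ hLanφ hsuppφ
      obtain ⟨q1, q2, -, -⟩ := H _ hη a M' ρ' (K - n) (⌈M₀⌉₊) (ρ' / F.L ^ (⌈M₀⌉₊ + 1)) hk hρL hM₀' hdiv hdM hRρ hR₀ hN₀ hρ₀ m hm1 hmk
        (fun j c => c ∈ cubeLamBP' (F.P K).L a M' ρ' (K - n) m j ∨ (j = 0 ∧ CrossB (cubeFam false (F.P K).L a M' ρ' (K - n) 0) c)) hI φ hLanφ hsuppφ
      exact twoLine_mono (msup_nonneg _ _ hη.le _ _ _) (wsup_nonneg zero_le_one _) (msup_nonneg _ _ hη.le _ _ _) hB hBbd ⟨q1, q2⟩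
    exact flat159_clause_of_scalar_bdryβ (𝔸 := Matrix (Fin 2) (Fin 2) ℂ) (d := (F.P K).d) (by rw [T3Family.P_d]; norm_num) hL1 hη m
      (fun j => cubeFam false (F.P K).L a M' ρ' (K - n) j) (cubeLamS (F.P K).L a M' ρ' (K - n) m)
      (fun j => cubeLamBP' (F.P K).L a M' ρ' (K - n) m j) (le_trans zero_le_one (hB₀l.trans hB)) (le_trans zero_le_one (hB₀l.trans hBbd)) hc0 hc
      SCALAR W A' hLan hWA hA0
  · refine ⟨1, 0, 0, le_rfl, fun F hF => ?_⟩
    exact absurd (hF ▸ F.hL.1) hodd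

end Summit.QuantumFields.YangMills.Theorems.HalvingH59GammaDischargeFlatAllLevels

end
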